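import Literature.Probability.RandomPlanarGeometry.WholePlaneRadialPiece
import Literature.Topology.PlaneTopology.ConnectedImKleinen
import HarnessLib

/-!
# The whole-plane Loewner hull is uniformly locally connected when the increments are generated by curves

Topic `Probability/RandomPlanarGeometry`; theorems only (no definition, no named fact). Sequel of
`WholePlaneLoewnerMarkov` / `WholePlaneRadialPiece` and of the plane-topology file
`Literature.Topology.PlaneTopology.ConnectedImKleinen`. This is the topological heart of a proof
of Miller–Sheffield (2013), Prop. 2.5 (whole-plane SLE_κ(ρ) is generated by a continuous curve)
that does not use the boundary behaviour of the radial pieces (and so also covers the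
boundary-hitting values `κ > 4` of the non-absorbing regime `ρ ≥ κ/2 - 2`, where the printed
argument via Lemma 2.4 does not apply): **if from base times `a` unbounded below the radial
Loewner chain in `𝔻` of the shifted driver is generated by a continuous curve — its domain at time
`s` is the component of `0` in `𝔻 ∖ η[0, s]` — then every hull `K_b` is uniformly locally
connected** (`WholePlaneLoewnerChain.isUniformlyLocallyConnected_hull`), hence (Carathéodory,
sequel file) `F_b = g_b⁻¹` extends continuously to the closed exterior disc.

* `RadialFill.exists_preconnected_join` — in the disc, the filled trace
  `A = {w ∈ 𝔻 : w ∉ D}`, `D` the component of `0` in `𝔻 ∖ P`, `P = η[0, s]` a Peano continuum, is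
  connected im kleinen at each of its points (points off `P` lie in open components; a point of
  `P` is joined to nearby points of `P` by small continua of `P` (uniform local connectedness of
  continuous images of intervals) and to nearby points off `P` by a straight segment up to its
  first point on `P`);
* `WholePlaneLoewnerChain.isCIKAt_hull_of_base` — by the radial Markov property
  (`compl_hull_add_eq`) the interior coordinate `Ψ_a = 1/g_a`, a homeomorphism of `ℂ ∖ K_a` onto
  the punctured disc with inverse `w ↦ F_a(1/w)`, carries `K_{a+s} ∖ K_a` onto `A ∖ {0}`; so
  `K_{a+s}` is connected im kleinen at each of its points off `K_a`;
* `WholePlaneLoewnerChain.isUniformlyLocallyConnected_hull` — since the hulls shrink to `{0}`,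
  `K_b` is connected im kleinen at every point `≠ 0`, hence (Moore's theorem
  `IsCIKAt.of_forall_ne`: a continuum has no isolated point of non-connectedness im kleinen) at `0`
  as well, and a compact set connected im kleinen everywhere is uniformly locally connected.

## References

* J. Miller, S. Sheffield, *Imaginary geometry IV*, PTRF 169 (2017), arXiv:1302.4738, §2.1.3,
  Prop. 2.5. [MillerSheffield2013]
* Ch. Pommerenke, *Boundary Behaviour of Conformal Maps*, Springer (1992), §2.2, Thm. 2.1.
  [PommerenkeBBCM1992]
* K. Kuratowski, *Topology* II (1968), §49.VI.
-/

noncomputable section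

open Set Filter Topology Metric Complex
open scoped NNReal
open Literature.Topology.PlaneTopology

namespace Literature.Probability.RandomPlanarGeometry

/-! ### The filled radial trace in the disc is connected im kleinen -/

namespace RadialFill

variable {η : ℝ≥0 → ℂ} {s : ℝ≥0}

/-- The trace `η[0, s]` as the image of a real interval. [folklore] -/
theorem image_Icc_eq_image_real (η : ℝ≥0 → ℂ) (s : ℝ≥0) :
    η '' Icc 0 s = (fun t : ℝ ↦ η t.toNNReal) '' Icc (0 : ℝ) s := by
  ext v
  constructor
  · rintro ⟨u, hu, rfl⟩
    exact ⟨u, ⟨u.2, NNReal.coe_le_coe.2 hu.2⟩, by simp only [Real.toNNReal_coe]⟩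
  · rintro ⟨t, ht, rfl⟩
    exact ⟨t.toNNReal, ⟨bot_le, Real.toNNReal_le_iff_le_coe.2 ht.2⟩, rfl⟩

/-- The trace is compact. [folklore] -/
theorem isCompact_trace (hη : Continuous η) (s : ℝ≥0) : IsCompact (η '' Icc 0 s) :=
  isCompact_Icc.image hη

/-- A component of `𝔻 ∖ P` other than that of `0` lies in the filled trace. [folklore] -/
theorem connectedComponentIn_subset_fill {P : Set ℂ} {v : ℂ} (hv : v ∈ ball (0 : ℂ) 1 \ P)
    (hvD : v ∉ connectedComponentIn (ball (0 : ℂ) 1 \ P) 0) :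
    connectedComponentIn (ball (0 : ℂ) 1 \ P) v ⊆
      {x | x ∈ ball (0 : ℂ) 1 ∧ x ∉ connectedComponentIn (ball (0 : ℂ) 1 \ P) 0} := by
  intro x hx
  refine ⟨(connectedComponentIn_subset _ _ hx).1, fun hxD ↦ hvD ?_⟩
  rw [connectedComponentIn_eq hxD, ← connectedComponentIn_eq hx]
  exact mem_connectedComponentIn hv

/-- **First entrance into a closed set along a path.** [folklore] -/
theorem exists_first_mem {γ : ℝ → ℂ} (hγ : Continuous γ) {P : Set ℂ} (hP : IsClosed P)
    (h0 : γ 0 ∉ P) (h1 : γ 1 ∈ P) :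
    ∃ t ∈ Ioc (0 : ℝ) 1, γ t ∈ P ∧ ∀ t' ∈ Ico 0 t, γ t' ∉ P := by
  set T : Set ℝ := Icc 0 1 ∩ γ ⁻¹' P with hT
  have hTc : IsClosed T := isClosed_Icc.inter (hP.preimage hγ)
  have hTne : T.Nonempty := ⟨1, ⟨zero_le_one, le_rfl⟩, h1⟩
  have hTbdd : BddBelow T := ⟨0, fun t ht ↦ ht.1.1⟩
  have hmem : sInf T ∈ T := hTc.csInf_mem hTne hTbdd
  have hpos : 0 < sInf T := by
    rcases hmem.1.1.eq_or_lt with h | h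
    · exact absurd (h ▸ hmem.2 : γ 0 ∈ P) h0
    · exact h
  refine ⟨sInf T, ⟨hpos, hmem.1.2⟩, hmem.2, fun t' ht' hP' ↦ ?_⟩
  have : sInf T ≤ t' := csInf_le hTbdd ⟨⟨ht'.1, ht'.2.le.trans hmem.1.2⟩, hP'⟩
  exact absurd ht'.2 (not_lt.2 this)

/-- **The filled radial trace is connected im kleinen** (in the form with joining continua): let
`P = η[0, s]` for a continuous `η`, `D` the component of `0` in `𝔻 ∖ P` and
`A = {w ∈ 𝔻 : w ∉ D}`; for `w ∈ A` and `δ > 0` there is `δ' > 0` such that every `w' ∈ A` with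
`|w' - w| < δ'` is joined to `w` by a preconnected subset of `A ∩ B(w, δ)`.
[cite: PommerenkeBBCM1992, §2.2] -/
theorem exists_preconnected_join (hη : Continuous η) (s : ℝ≥0) {w : ℂ} (hw1 : w ∈ ball (0 : ℂ) 1)
    (hwD : w ∉ connectedComponentIn (ball (0 : ℂ) 1 \ η '' Icc 0 s) 0) {δ : ℝ} (hδ : 0 < δ) :
    ∃ δ' > 0, ∀ w' ∈ ball (0 : ℂ) 1, w' ∉ connectedComponentIn (ball (0 : ℂ) 1 \ η '' Icc 0 s) 0 →
      dist w' w < δ' →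
        ∃ S ⊆ {x | x ∈ ball (0 : ℂ) 1 ∧ x ∉ connectedComponentIn (ball (0 : ℂ) 1 \ η '' Icc 0 s) 0} ∩ ball w δ,
          IsPreconnected S ∧ w ∈ S ∧ w' ∈ S := by
  set P : Set ℂ := η '' Icc 0 s with hPdef
  set O : Set ℂ := ball (0 : ℂ) 1 \ P with hO
  set D : Set ℂ := connectedComponentIn O 0 with hD
  set A : Set ℂ := {x | x ∈ ball (0 : ℂ) 1 ∧ x ∉ D} with hA
  have hPc : IsCompact P := isCompact_trace hη s
  have hPcl : IsClosed P := hPc.isClosed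
  have hOo : IsOpen O := isOpen_ball.sdiff hPcl
  -- room inside the disc
  set δ₀ : ℝ := min δ (1 - ‖w‖) with hδ₀
  have hw1' : ‖w‖ < 1 := mem_ball_zero_iff.1 hw1
  have hδ₀pos : 0 < δ₀ := lt_min hδ (by linarith)
  have hδ₀δ : δ₀ ≤ δ := min_le_left _ _
  have hδ₀w : δ₀ ≤ 1 - ‖w‖ := min_le_right _ _
  have hball : ∀ v, dist v w < δ₀ → v ∈ ball (0 : ℂ) 1 := fun v hv ↦ by
    rw [mem_ball_zero_iff]
    calc ‖v‖ = ‖(v - w) + w‖ := by rw [sub_add_cancel]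
      _ ≤ ‖v - w‖ + ‖w‖ := norm_add_le _ _
      _ < δ₀ + ‖w‖ := by rw [← dist_eq_norm]; linarith
      _ ≤ 1 := by linarith
  by_cases hwP : w ∈ P
  · -- `w` on the trace: small continua of `P`, and segments to first points of `P`
    have hULC : IsUniformlyLocallyConnected P := by
      rw [hPdef, image_Icc_eq_image_real]
      exact IsUniformlyLocallyConnected.of_image_Icc
        ((hη.comp continuous_real_toNNReal).continuousOn)
    obtain ⟨δ₁, hδ₁, hjoin⟩ := hULC (δ₀ / 3) (by positivity)
    -- joining `w` to a nearby point of `P` inside `A ∩ B(w, δ₀/3]`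
    have hPjoin : ∀ v ∈ P, dist w v < δ₁ → ∃ σ ⊆ A ∩ closedBall w (δ₀ / 3),
        IsPreconnected σ ∧ w ∈ σ ∧ v ∈ σ := by
      intro v hv hwv
      obtain ⟨σ, hσP, -, hσc, hwσ, hvσ, hσball⟩ := hjoin w hwP v hv hwv
      refine ⟨σ, fun x hx ↦ ⟨⟨hball x ?_, fun hxD ↦ ?_⟩, hσball hx⟩, hσc, hwσ, hvσ⟩
      · exact (mem_closedBall.1 (hσball hx)).trans_lt (by linarith)
      · exact (connectedComponentIn_subset _ _ hxD).2 (hσP hx)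
    refine ⟨min δ₁ (δ₀ / 3), lt_min hδ₁ (by positivity), fun w' hw'1 hw'D hw'w ↦ ?_⟩
    have hw'δ₁ : dist w w' < δ₁ := by rw [dist_comm]; exact hw'w.trans_le (min_le_left _ _)
    have hw'δ₀ : dist w' w < δ₀ / 3 := hw'w.trans_le (min_le_right _ _)
    by_cases hw'P : w' ∈ P
    · obtain ⟨σ, hσA, hσc, hwσ, hw'σ⟩ := hPjoin w' hw'P hw'δ₁
      refine ⟨σ, fun x hx ↦ ⟨(hσA hx).1, ?_⟩, hσc, hwσ, hw'σ⟩
      exact mem_ball.2 ((mem_closedBall.1 (hσA hx).2).trans_lt (by linarith))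
    · -- the segment from `w'` towards `w`, up to its first point on `P`
      set γ : ℝ → ℂ := fun t ↦ w' + (t : ℂ) * (w - w') with hγ
      have hγc : Continuous γ := by rw [hγ]; fun_prop
      have hγ0 : γ 0 = w' := by simp [hγ]
      have hγ1 : γ 1 = w := by simp [hγ]
      have hγdist : ∀ t ∈ Icc (0 : ℝ) 1, dist (γ t) w ≤ dist w' w := by
        intro t ht
        have : γ t - w = ((1 - t : ℝ) : ℂ) * (w' - w) := by
          simp only [hγ]; push_cast; ring
        rw [dist_eq_norm, this, norm_mul, Complex.norm_real, Real.norm_eq_abs,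
          abs_of_nonneg (by linarith [ht.2]), dist_eq_norm]
        exact mul_le_of_le_one_left (norm_nonneg _) (by linarith [ht.1])
      obtain ⟨t₁, ht₁, ht₁P, hbefore⟩ :=
        exists_first_mem hγc hPcl (by rwa [hγ0]) (by rwa [hγ1])
      -- the open initial piece lies in the component of `w'`, inside `A`
      have hw'O : w' ∈ O := ⟨hw'1, hw'P⟩
      have hIco : γ '' Ico 0 t₁ ⊆ A := by
        have h1 : γ '' Ico 0 t₁ ⊆ O := by
          rintro _ ⟨t, ht, rfl⟩
          exact ⟨hball _ ((hγdist t ⟨ht.1, ht.2.le.trans ht₁.2⟩).trans_lt (by linarith)),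
            hbefore t ht⟩
        have h2 : γ '' Ico 0 t₁ ⊆ connectedComponentIn O w' :=
          (isPreconnected_Ico.image γ hγc.continuousOn).subset_connectedComponentIn
            ⟨0, ⟨le_rfl, ht₁.1⟩, hγ0⟩ h1
        exact h2.trans (connectedComponentIn_subset_fill hw'O hw'D)
      have hw''A : γ t₁ ∈ A :=
        ⟨hball _ ((hγdist t₁ ⟨ht₁.1.le, ht₁.2⟩).trans_lt (by linarith)), fun hD' ↦
          (connectedComponentIn_subset _ _ hD').2 ht₁P⟩
      have hIcc : γ '' Icc 0 t₁ ⊆ A := by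
        rintro _ ⟨t, ht, rfl⟩
        rcases ht.2.eq_or_lt with rfl | hlt
        · exact hw''A
        · exact hIco ⟨t, ⟨ht.1, hlt⟩, rfl⟩
      have hw''δ₁ : dist w (γ t₁) < δ₁ := by
        rw [dist_comm]
        exact ((hγdist t₁ ⟨ht₁.1.le, ht₁.2⟩).trans_lt hw'w).trans_le (min_le_left _ _)
      obtain ⟨σ, hσA, hσc, hwσ, hw''σ⟩ := hPjoin (γ t₁) ht₁P hw''δ₁
      refine ⟨γ '' Icc 0 t₁ ∪ σ, ?_, ?_, Or.inr hwσ, Or.inl ⟨0, ⟨le_rfl, ht₁.1.le⟩, hγ0⟩⟩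
      · rintro x (⟨t, ht, rfl⟩ | hx)
        · refine ⟨hIcc ⟨t, ht, rfl⟩, mem_ball.2 ?_⟩
          exact ((hγdist t ⟨ht.1, ht.2.trans ht₁.2⟩).trans_lt hw'w).trans_le
            ((min_le_right _ _).trans (by linarith))
        · exact ⟨(hσA hx).1, mem_ball.2 ((mem_closedBall.1 (hσA hx).2).trans_lt (by linarith))⟩
      · exact IsPreconnected.union (γ t₁) ⟨t₁, ⟨ht₁.1.le, le_rfl⟩, rfl⟩ hw''σ
          (isPreconnected_Icc.image γ hγc.continuousOn) hσc
  · -- `w` off the trace: an open component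
    have hwO : w ∈ O := ⟨hw1, hwP⟩
    have hUo : IsOpen (connectedComponentIn O w) := hOo.connectedComponentIn
    obtain ⟨r, hr, hrU⟩ := Metric.isOpen_iff.1 hUo w (mem_connectedComponentIn hwO)
    refine ⟨min r δ₀, lt_min hr hδ₀pos, fun w' _ _ hw'w ↦ ?_⟩
    refine ⟨ball w (min r δ₀), fun x hx ↦ ⟨?_, ball_subset_ball ((min_le_right _ _).trans hδ₀δ) hx⟩,
      (convex_ball w _).isPreconnected, mem_ball_self (lt_min hr hδ₀pos), mem_ball.2 hw'w⟩
    exact connectedComponentIn_subset_fill hwO hwD (hrU (ball_subset_ball (min_le_left _ _) hx))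

end RadialFill

/-! ### The whole-plane hull is connected im kleinen off the earlier hull -/

namespace WholePlaneLoewnerChain

variable {lam : ℝ → ℝ}

/-- **Membership in a later hull, read in the interior coordinate**: for `z ∉ K_a`, `z ∈ K_{a+s}`
iff `Ψ_a z = 1/g_a(z)` is not in the radial domain at time `s` of the shifted driver
(`compl_hull_add_eq`). [cite: MillerSheffield2013, §2.1.3] -/
theorem mem_hull_add_iff_invCoord_notMem (C : WholePlaneLoewnerChain lam) (hlam : Continuous lam)
    {a : ℝ} {s : ℝ≥0} {z : ℂ} (hz : z ∉ C.hull a) :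
    z ∈ C.hull (a + s) ↔
      (C.map a z)⁻¹ ∉ RadialLoewner.Disc.domain (WholePlaneLoewner.shiftDriver lam a) s := by
  have h := Set.ext_iff.1 (C.compl_hull_add_eq hlam a s) z
  simp only [mem_compl_iff, mem_setOf_eq] at h
  tauto

/-- **`K_{a+s}` is connected im kleinen at each of its points off `K_a`, when the radial chain of
the shifted driver from the base `a` is generated by a curve up to time `s`.**
[cite: MillerSheffield2013, Prop. 2.5 (proof)] -/
theorem isCIKAt_hull_of_base (C : WholePlaneLoewnerChain lam) (hlam : Continuous lam)
    {a : ℝ} {s : ℝ≥0} {η : ℝ≥0 → ℂ} (hη : Continuous η)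
    (hdom : RadialLoewner.Disc.domain (WholePlaneLoewner.shiftDriver lam a) s =
      connectedComponentIn (ball (0 : ℂ) 1 \ η '' Icc 0 s) 0)
    {z : ℂ} (hzK : z ∈ C.hull (a + s)) (hza : z ∉ C.hull a) : IsCIKAt (C.hull (a + s)) z := by
  set Ψ : ℂ → ℂ := fun z ↦ (C.map a z)⁻¹ with hΨ
  set Φ : ℂ → ℂ := fun w ↦ WholePlaneLoewner.BackwardFlow.invMap lam a w⁻¹ with hΦ
  set D : Set ℂ := connectedComponentIn (ball (0 : ℂ) 1 \ η '' Icc 0 s) 0 with hD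
  set A : Set ℂ := {x | x ∈ ball (0 : ℂ) 1 ∧ x ∉ D} with hA
  -- the dictionary
  have hmemK : ∀ {z'}, z' ∉ C.hull a → (z' ∈ C.hull (a + s) ↔ Ψ z' ∉ D) := fun hz' ↦ by
    rw [C.mem_hull_add_iff_invCoord_notMem hlam hz', hdom]
  have hΨmem : ∀ {z'}, z' ∉ C.hull a → Ψ z' ∈ ball (0 : ℂ) 1 \ {0} := fun hz' ↦ C.invCoord_mem hz'
  have hΦΨ : ∀ {z'}, z' ∉ C.hull a → Φ (Ψ z') = z' := fun hz' ↦ C.invMap_inv_invCoord hlam hz'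
  have hΦnot : ∀ {w}, w ∈ ball (0 : ℂ) 1 \ {0} → Φ w ∉ C.hull a := fun hw ↦
    C.invMap_inv_notMem_hull hlam hw.2 (mem_ball_zero_iff.1 hw.1)
  have hΨΦ : ∀ {w}, w ∈ ball (0 : ℂ) 1 \ {0} → Ψ (Φ w) = w := fun hw ↦
    C.invCoord_invMap_inv hlam hw.2 (mem_ball_zero_iff.1 hw.1)
  have hΦK : ∀ {w}, w ∈ ball (0 : ℂ) 1 \ {0} → w ∉ D → Φ w ∈ C.hull (a + s) := fun hw hwD ↦
    (hmemK (hΦnot hw)).2 (by rwa [hΨΦ hw])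
  set w : ℂ := Ψ z with hw
  have hwmem : w ∈ ball (0 : ℂ) 1 \ {0} := hΨmem hza
  have hwD : w ∉ D := (hmemK hza).1 hzK
  have hΦw : Φ w = z := hΦΨ hza
  rw [IsCIKAt.iff_exists]
  intro ε hε
  -- continuity of `Φ` at `w` (on the open punctured disc)
  have hopen : IsOpen (ball (0 : ℂ) 1 \ {0}) := isOpen_ball.sdiff isClosed_singleton
  have hΦc : ContinuousAt Φ w :=
    ((continuousOn_invMap_inv hlam).continuousAt (hopen.mem_nhds hwmem))
  obtain ⟨δ, hδ, hδε⟩ : ∃ δ > 0, ball w δ ⊆ ball (0 : ℂ) 1 \ {0} ∧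
      ∀ v, dist v w < δ → dist (Φ v) (Φ w) < ε := by
    obtain ⟨δ₁, hδ₁, h₁⟩ := Metric.continuousAt_iff.1 hΦc ε hε
    obtain ⟨δ₂, hδ₂, h₂⟩ := Metric.isOpen_iff.1 hopen w hwmem
    exact ⟨min δ₁ δ₂, lt_min hδ₁ hδ₂, ⟨(ball_subset_ball (min_le_right _ _)).trans h₂,
      fun v hv ↦ h₁ (hv.trans_le (min_le_left _ _))⟩⟩
  obtain ⟨hδball, hδcont⟩ := hδε
  -- connectedness im kleinen of the filled trace at `w`
  obtain ⟨δ', hδ', hjoin⟩ := RadialFill.exists_preconnected_join hη s hwmem.1 hwD hδ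
  -- continuity of `Ψ` at `z` (on the open complement of `K_a`)
  have hopen' : IsOpen (C.hull a)ᶜ := (C.isCompact_hull a).isClosed.isOpen_compl
  have hΨc : ContinuousAt Ψ z := (C.continuousOn_invCoord a).continuousAt (hopen'.mem_nhds hza)
  obtain ⟨ρ, hρ, hρK, hρcont⟩ : ∃ ρ > 0, ball z ρ ⊆ (C.hull a)ᶜ ∧
      ∀ z', dist z' z < ρ → dist (Ψ z') (Ψ z) < δ' := by
    obtain ⟨ρ₁, hρ₁, h₁⟩ := Metric.continuousAt_iff.1 hΨc δ' hδ'
    obtain ⟨ρ₂, hρ₂, h₂⟩ := Metric.isOpen_iff.1 hopen' z hza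
    exact ⟨min ρ₁ ρ₂, lt_min hρ₁ hρ₂, (ball_subset_ball (min_le_right _ _)).trans h₂,
      fun z' hz' ↦ h₁ (hz'.trans_le (min_le_left _ _))⟩
  refine ⟨ρ, hρ, fun z' hz'K hz'z ↦ ?_⟩
  have hz'a : z' ∉ C.hull a := hρK (mem_ball.2 hz'z)
  have hw'mem : Ψ z' ∈ ball (0 : ℂ) 1 \ {0} := hΨmem hz'a
  have hw'D : Ψ z' ∉ D := (hmemK hz'a).1 hz'K
  obtain ⟨S, hSsub, hSc, hwS, hw'S⟩ := hjoin (Ψ z') hw'mem.1 hw'D (hρcont z' hz'z)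
  have hSball : S ⊆ ball (0 : ℂ) 1 \ {0} := fun v hv ↦ hδball (hSsub hv).2
  have hΦcS : ContinuousOn Φ S := (continuousOn_invMap_inv hlam).mono hSball
  refine ⟨Φ '' S, ?_, hSc.image Φ hΦcS, ⟨w, hwS, hΦw⟩, ⟨Ψ z', hw'S, hΦΨ hz'a⟩⟩
  rintro _ ⟨v, hv, rfl⟩
  refine ⟨hΦK (hSball hv) (hSsub hv).1.2, mem_ball.2 ?_⟩
  rw [← hΦw]
  exact hδcont v (mem_ball.1 (hSsub hv).2)

/-- **The whole-plane hull is uniformly locally connected** when, from base times unbounded below,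
the radial chain of the shifted driver is generated by a continuous curve up to every time: then
`K_b` is connected im kleinen at every point other than `0` (`isCIKAt_hull_of_base`, the hulls
shrinking to `{0}`), hence at `0` by Moore's theorem, hence uniformly locally connected.
[cite: MillerSheffield2013, Prop. 2.5 (proof)] -/
theorem isUniformlyLocallyConnected_hull (C : WholePlaneLoewnerChain lam) (hlam : Continuous lam)
    {B : Set ℝ} (hB : ∀ T : ℝ, ∃ a ∈ B, a < T)
    (hgen : ∀ a ∈ B, ∀ s : ℝ≥0, ∃ η : ℝ≥0 → ℂ, Continuous η ∧
      RadialLoewner.Disc.domain (WholePlaneLoewner.shiftDriver lam a) s =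
        connectedComponentIn (ball (0 : ℂ) 1 \ η '' Icc 0 s) 0)
    (b : ℝ) : IsUniformlyLocallyConnected (C.hull b) := by
  refine isUniformlyLocallyConnected_of_forall_ne (C.isCompact_hull b)
    (C.isInteriorHull b).2.1.isPreconnected (p := 0) fun z hzK hz0 ↦ ?_
  -- an early base `a < b` with `z ∉ K_a`
  have hU : ({z}ᶜ : Set ℂ) ∈ 𝓝 (0 : ℂ) := isOpen_compl_singleton.mem_nhds fun h ↦ hz0 h.symm
  obtain ⟨T₀, hT₀⟩ := (C.eventually_hull_subset hU).exists_forall_of_atBot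
  obtain ⟨a, haB, hab⟩ := hB (min T₀ b)
  have hza : z ∉ C.hull a := fun h ↦ hT₀ a (hab.le.trans (min_le_left _ _)) h rfl
  have hab' : a < b := hab.trans_le (min_le_right T₀ b)
  set s : ℝ≥0 := (b - a).toNNReal with hs
  have hbs : a + (s : ℝ) = b := by rw [hs, Real.coe_toNNReal _ (by linarith)]; ring
  obtain ⟨η, hη, hdom⟩ := hgen a haB s
  rw [← hbs] at hzK ⊢
  exact C.isCIKAt_hull_of_base hlam hη hdom hzK hza

end WholePlaneLoewnerChain

end Literature.Probability.RandomPlanarGeometry
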